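import Literature.NumberTheory.LFunctions.LevinsonConreyPrincipal
import Literature.NumberTheory.LFunctions.ConreyVHorizontalEdges
import HarnessLib

/-!
# Levinson–Conrey: `N₀(T₂) − N₀(T₁) ≥ N(T₂) − N(T₁) − 2N_V − O(log T₂)`

Topic `Literature/NumberTheory/LFunctions`. Everything here is PROVED; there are no definitions
and no named facts.

This file closes the "soft" part of Levinson's method in Conrey's form (J. Number Theory 16
(1983), §4 (1)–(3); Titchmarsh §10.28 (10.28.7)): combining

* the structural inequality `Literature.NumberTheory.LFunctions.levinsonConrey_criticalZeroCount_ge`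
  (argument principle for `V = conreyV 𝜙 L` on `[½, b] × [T₁, T₂]`, zeros of `c·Λ = Q + Q♯` on the
  critical segment) with `b = 5/2`,
* the right-edge bound `|Δ arg V(5/2 + it)| ≤ π`
  (`Literature.NumberTheory.LFunctions.conreyV_rightEdge_argVariation`),
* the horizontal Backlund bounds `|Δ arg V(σ + iT)|_{½≤σ≤5/2} ≤ C log T`
  (`Literature.NumberTheory.LFunctions.conreyV_horizontal_argVariation`),
* `S(T) = O(log T)` (`Literature.NumberTheory.LFunctions.isBigO_zetaArgS_log_holds`),

we obtain `levinsonConrey_inequality`: for a real polynomial `𝜙` with `𝜙(x) + 𝜙(1−x) = c ≠ 0` and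
`𝜙(0) ≠ 0` there are `L₀, T₀, C'` such that for `L ≥ L₀`, `T₀ ≤ T₁ < T₂` and `V ≠ 0` on the two
horizontal segments `[½, 5/2] × {T₁}`, `[½, 5/2] × {T₂}`,

  `N₀(T₂) − N₀(T₁) ≥ N(T₂) − N(T₁) − 2 N_V − C' log T₂`,

`N_V` the number of zeros of `V` in the open rectangle `(½, 5/2) × (T₁, T₂)` counted with
multiplicity. What remains of Levinson's method after this is the upper bound for `N_V` by
Littlewood's lemma applied to `ψV` and the mollified mean square
(`Literature.NumberTheory.LFunctions.littlewood_count_le_of_meanSquare`; Conrey §4 (4), PRZZ 2020).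

## References

* J. B. Conrey, *Zeros of derivatives of Riemann's ξ-function on the critical line*, J. Number
  Theory 16 (1983), 49–74, §4 (1)–(3). [Conrey1983]
* E. C. Titchmarsh, *The Theory of the Riemann Zeta-Function*, 2nd ed. (1986), §10.28 (10.28.7).
  [Titchmarsh1986]
* K. Pratt, N. Robles, A. Zaharescu, D. Zeindler, *More than five-twelfths of the zeros of `ζ` are
  on the critical line*, Res. Math. Sci. 7 (2020), §1.3. [PrattRoblesZaharescuZeindler2020]
-/

noncomputable section

open Complex Polynomial Set Filter Topology Metric MeasureTheory Asymptotics
open scoped Real ComplexConjugate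

namespace Literature.NumberTheory.LFunctions

open Literature.Analysis.Complex SiegelIntegral

/-- **`|S(T)| ≤ C_S log T` for `T ≥ T_S`** (from the tree's `S(T) = O(log T)`,
`Literature.NumberTheory.LFunctions.isBigO_zetaArgS_log_holds`). [cite: Titchmarsh1986, Thm. 9.4] -/
theorem exists_abs_zetaArgS_le_mul_log :
    ∃ C T : ℝ, 0 < C ∧ 1 ≤ T ∧ ∀ t : ℝ, T ≤ t → |zetaArgS t| ≤ C * Real.log t := by
  have h := isBigO_zetaArgS_log_holds
  rw [isBigO_zetaArgS_log, Asymptotics.isBigO_iff] at h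
  obtain ⟨c, hc⟩ := h
  obtain ⟨T, hT⟩ := Filter.eventually_atTop.1 (hc.and (Filter.eventually_ge_atTop (1 : ℝ)))
  refine ⟨max c 1, max T 1, by positivity, le_max_right _ _, fun t ht ↦ ?_⟩
  obtain ⟨h1, h2⟩ := hT t (le_trans (le_max_left _ _) ht)
  rw [Real.norm_eq_abs, Real.norm_eq_abs, abs_of_nonneg (Real.log_nonneg h2)] at h1
  exact h1.trans (mul_le_mul_of_nonneg_right (le_max_left _ _) (Real.log_nonneg h2))

/-- **The Levinson–Conrey inequality** (Conrey 1983, §4 (1)–(3); Titchmarsh (10.28.7)): let `𝜙` be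
a real polynomial with `𝜙(x) + 𝜙(1 − x) = c ≠ 0` and `𝜙(0) ≠ 0`, and `V = conreyV 𝜙 L`. There are
`L₀ ≥ 1`, `T₀ > 0`, `C' > 0` such that for all `L ≥ L₀` and `T₀ ≤ T₁ < T₂` for which `V` has no zero
on the horizontal segments `[½, 5/2] × {T₁}` and `[½, 5/2] × {T₂}`,
`N₀(T₂) − N₀(T₁) ≥ (N(T₂) − N(T₁)) − 2 Σ_{ρ : V(ρ)=0, ρ ∈ (½,5/2)×(T₁,T₂)} m_V(ρ) − C' log T₂`.
[cite: Conrey1983, §4 (3)] -/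
theorem levinsonConrey_inequality {φ : ℝ[X]} {c : ℝ} (hφ : φ + φ.comp (1 - X) = C c) (hc : c ≠ 0)
    (hφ0 : φ.coeff 0 ≠ 0) :
    ∃ L₀ T₀ C' : ℝ, 1 ≤ L₀ ∧ 0 < T₀ ∧ 0 < C' ∧ ∀ L : ℝ, L₀ ≤ L → ∀ T₁ T₂ : ℝ, T₀ ≤ T₁ → T₁ < T₂ →
      (∀ x ∈ Icc (1 / 2 : ℝ) (5 / 2), conreyV φ L (x + T₁ * I) ≠ 0) →
      (∀ x ∈ Icc (1 / 2 : ℝ) (5 / 2), conreyV φ L (x + T₂ * I) ≠ 0) →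
        ((zetaZeroCount T₂ : ℝ) - zetaZeroCount T₁) -
            2 * ∑ᶠ ρ ∈ {ρ : ℂ | conreyV φ L ρ = 0 ∧ ρ ∈ Ioo (1 / 2 : ℝ) (5 / 2) ×ℂ Ioo T₁ T₂},
              ((meromorphicOrderAt (conreyV φ L) ρ).untop₀ : ℝ) -
            C' * Real.log T₂ ≤
          (criticalZeroCount T₂ : ℝ) - criticalZeroCount T₁ := by
  have hπ := Real.pi_pos
  obtain ⟨L₁, U₁, hL₁, hU₁, hE⟩ := conreyV_rightEdge_argVariation φ hφ0
  obtain ⟨L₂, U₂, C₂, hL₂, hU₂, hC₂, hH⟩ := conreyV_horizontal_argVariation φ hφ0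
  obtain ⟨CS, US, hCS, hUS, hS⟩ := exists_abs_zetaArgS_le_mul_log
  set L₀ : ℝ := max L₁ L₂ with hL₀
  set T₀ : ℝ := max (max U₁ U₂) (max US 3) with hT₀
  set C' : ℝ := 2 * CS + 2 * C₂ / π + 2 with hC'
  refine ⟨L₀, T₀, C', le_trans hL₁ (le_max_left _ _), lt_of_lt_of_le hU₁ (le_trans (le_max_left _ _)
    (le_max_left _ _)), by positivity, fun L hL T₁ T₂ hT₁ hT₁₂ h_bot h_top ↦ ?_⟩
  -- unpack the thresholds
  have hLL₁ : L₁ ≤ L := le_trans (le_max_left _ _) hL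
  have hLL₂ : L₂ ≤ L := le_trans (le_max_right _ _) hL
  have hU₁T₁ : U₁ ≤ T₁ := le_trans (le_trans (le_max_left _ _) (le_max_left _ _)) hT₁
  have hU₂T₁ : U₂ ≤ T₁ := le_trans (le_trans (le_max_right _ _) (le_max_left _ _)) hT₁
  have hUST₁ : US ≤ T₁ := le_trans (le_trans (le_max_left _ _) (le_max_right _ _)) hT₁
  have h3T₁ : 3 ≤ T₁ := le_trans (le_trans (le_max_right _ _) (le_max_right _ _)) hT₁
  have hT₁0 : 0 < T₁ := by linarith
  have hT₂0 : 0 < T₂ := by linarith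
  have hlogT₂ : 1 ≤ Real.log T₂ := by
    rw [← Real.log_exp 1]
    refine Real.log_le_log (Real.exp_pos 1) ?_
    have := Real.exp_one_lt_d9
    linarith
  have hlog12 : Real.log T₁ ≤ Real.log T₂ := Real.log_le_log hT₁0 hT₁₂.le
  have hlogT₁0 : 0 ≤ Real.log T₁ := Real.log_nonneg (by linarith)
  obtain ⟨_, hne, harg⟩ := hE L hLL₁
  -- the structural inequality with `b = 5/2`
  have hmain := levinsonConrey_criticalZeroCount_ge hφ hc L (b := 5 / 2) (by norm_num) (by norm_num)
    hT₁0 hT₁₂ h_bot h_top (fun y hy ↦ hne y (le_trans hU₁T₁ hy.1))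
  -- the four error terms
  have hbot := hH L hLL₂ T₁ hU₂T₁ h_bot
  have htop := hH L hLL₂ T₂ (by linarith) h_top
  have hright := harg T₁ T₂ hU₁T₁ hT₁₂.le
  have hS₁ := hS T₁ hUST₁
  have hS₂ := hS T₂ (by linarith)
  set Ib := (∫ x in (1 / 2 : ℝ)..(5 / 2), deriv (conreyV φ L) (x + T₁ * I) / conreyV φ L (x + T₁ * I)).im
  set It := (∫ x in (1 / 2 : ℝ)..(5 / 2), deriv (conreyV φ L) (x + T₂ * I) / conreyV φ L (x + T₂ * I)).im
  set Ir := ∫ y in T₁..T₂, (deriv (conreyV φ L) (((5 / 2 : ℝ) : ℂ) + y * I) /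
    conreyV φ L (((5 / 2 : ℝ) : ℂ) + y * I)).re
  set NV := ∑ᶠ ρ ∈ {ρ : ℂ | conreyV φ L ρ = 0 ∧ ρ ∈ Ioo (1 / 2 : ℝ) (5 / 2) ×ℂ Ioo T₁ T₂},
    ((meromorphicOrderAt (conreyV φ L) ρ).untop₀ : ℝ)
  have hIb : |Ib| ≤ C₂ * Real.log T₂ := hbot.trans (mul_le_mul_of_nonneg_left hlog12 hC₂.le)
  have hIt : |It| ≤ C₂ * Real.log T₂ := htop
  have hS₁' : |zetaArgS T₁| ≤ CS * Real.log T₂ := hS₁.trans (mul_le_mul_of_nonneg_left hlog12 hCS.le)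
  -- `(Ib - It + Ir)/π ≥ -(2 C₂ log T₂ + π)/π`
  have hquot : -(2 * C₂ / π * Real.log T₂ + 1) ≤ (Ib - It + Ir) / π := by
    rw [le_div_iff₀ hπ]
    have h1 := neg_abs_le Ib
    have h2 := le_abs_self It
    have h3 := neg_abs_le Ir
    have e : -(2 * C₂ / π * Real.log T₂ + 1) * π = -(2 * C₂ * Real.log T₂ + π) := by
      field_simp
    rw [e]
    linarith
  have hSS : -(2 * CS * Real.log T₂) ≤ -(zetaArgS T₂ - zetaArgS T₁) := by
    have h1 := le_abs_self (zetaArgS T₂)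
    have h2 := neg_abs_le (zetaArgS T₁)
    linarith
  have hC'log : C' * Real.log T₂ = 2 * CS * Real.log T₂ + 2 * C₂ / π * Real.log T₂ + 2 * Real.log T₂ := by
    rw [hC']; ring
  rw [hC'log]
  linarith

end Literature.NumberTheory.LFunctions

end
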